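import Literature.Computability.Complexity.InteractiveProofs
import Literature.Computability.Complexity.Counting
import Literature.Computability.Complexity.PolyHierarchy
import HarnessLib

/-!
# Lund–Fortnow–Karloff–Nisan: algebraic methods for interactive proof systems (statements)

Topic `Computability/Complexity`, namespace `Literature.Computability.Complexity`.

The two headline statements of Lund–Fortnow–Karloff–Nisan, *Algebraic methods for interactive
proof systems*, J. ACM 39 (1992) 859–868 (held: `paper:doi-10-1145-146585-146605`), over the tree's
private-coin interactive proofs `IP` (`InteractiveProofs.lean`, Arora–Barak Def. 8.6) and the
counting / hierarchy classes `PSharpP = P^{#P}` (`Counting.lean`), `PH`, `coNP`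
(`PolyHierarchy.lean`, `Nondeterministic.lean`):

* `LundEtAl1992_thm1` — **Theorem 1** (p. 861): "Every language in `P^{#P}` has an interactive
  proof system."  Named fact (the printed proof is the sumcheck protocol for the permanent /
  `#SAT`; the tree has its deterministic core over `ℤ` in `SumcheckCNF.lean` —
  `Sumcheck.soundness`, `Sumcheck.completeness` — and the `MA` simulation in `SumcheckMA*.lean`,
  but not yet the assembled `IP` verifier).
* `LundEtAl1992_cor2` — **Corollary 2** (p. 861, "together with Toda's result that `P^{#P}`
  contains all the languages of the polynomial-time hierarchy"): "Every language in the
  polynomial-time hierarchy has an interactive proof system. In particular, every language in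
  co-NP has an interactive proof system."  Named fact; `LundEtAl1992_cor2.coNP_subset_IP` is its
  second clause.

What is deliberately NOT here. (i) Shamir's `IP = PSPACE` (a different paper). (ii) Any bound on
the HONEST PROVER: the paper's closing discussion (p. 867) records that "in the above protocol the
prover must answer `#P`-complete questions, even for a co-NP-complete language, co-SAT", and asks
— an OPEN QUESTION, restated by Fortnow–Rompel–Sipser 1994 §7 and Aaronson–Wigderson 2008 §11 (4)
— "Is there an interactive proof system for co-SAT where the prover need only answer questions
about the satisfiability of CNF formulas? Such a proof system would give an instance checker for
NP-complete languages."  That question is the object of the route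
`Summits/PneNP/PneNP/Theses/UncheckableSAT.lean` (its `Thesis` is the negative answer, typed with an
`FP^{SAT}` honest prover; its item `SharpPProverSuffices` is Corollary 2 for `UNSAT` STRENGTHENED by
the `FP^{#P}` prover bound, which the printed corollary does not assert); no `def` is made of it
here (an open question is not a fact).

## References

* C. Lund, L. Fortnow, H. Karloff, N. Nisan, *Algebraic methods for interactive proof systems*,
  J. ACM 39(4) (1992) 859–868, Thm. 1 and Cor. 2 (p. 861), §4 discussion (p. 867).
* S. Arora, B. Barak, *Computational Complexity: A Modern Approach*, CUP 2009, §8.3 Thm. 8.21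
  (`#SAT_D ∈ IP`), §8.4 item 2 (p. 158 = PDF p. 196 of the held copy: "it is an open problem
  whether the protocol can be redesigned to use a weaker prover").
-/

namespace Literature.Computability.Complexity

/-- **Lund–Fortnow–Karloff–Nisan 1992, Theorem 1**: "Every language in `P^{#P}` has an
interactive proof system" — over the tree's classes, `P^{#P} ⊆ IP` (`PSharpP` of `Counting.lean`:
polynomial time with one `#P` function oracle answered in binary; `IP` of `InteractiveProofs.lean`:
private coins, `n^c` messages, completeness `2/3`, soundness `1/3` against all provers). Named fact
(grounds the "`#P` rung" of `Summit.PneNP.PneNP.Theses.UncheckableSAT`: cf. its item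
`SharpPProverSuffices`, which is stronger — it also bounds the honest prover).
[cite: LundEtAl1992, Thm. 1 (p. 861)] -/
def LundEtAl1992_thm1 : Prop :=
  PSharpP ⊆ IP

/-- **Lund–Fortnow–Karloff–Nisan 1992, Corollary 2**: "Every language in the polynomial-time
hierarchy has an interactive proof system. In particular, every language in co-NP has an
interactive proof system" — `PH ⊆ IP ∧ coNP ⊆ IP` over the tree's `PH`, `coNP`, `IP`. (Printed
derivation: Theorem 1 with Toda's theorem `PH ⊆ P^{#P}`; the co-NP clause alone follows from
Theorem 1 and `coNP ⊆ P^{#P}`, or directly from the `#SAT` protocol, Arora–Barak Thm. 8.21.)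
Named fact; grounds `Summit.PneNP.PneNP.Theses.UncheckableSAT.SharpPProverSuffices` up to the
honest-prover bound, which the printed corollary does not assert.
[cite: LundEtAl1992, Cor. 2 (p. 861)] -/
def LundEtAl1992_cor2 : Prop :=
  PH ⊆ IP ∧ coNP ⊆ IP

/-- The co-NP clause of Corollary 2: `coNP ⊆ IP`. [cite: LundEtAl1992, Cor. 2 (p. 861)] -/
theorem LundEtAl1992_cor2.coNP_subset_IP (h : LundEtAl1992_cor2) : coNP ⊆ IP :=
  h.2

/-- The PH clause of Corollary 2: `PH ⊆ IP`. [cite: LundEtAl1992, Cor. 2 (p. 861)] -/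
theorem LundEtAl1992_cor2.PH_subset_IP (h : LundEtAl1992_cor2) : PH ⊆ IP :=
  h.1

end Literature.Computability.Complexity
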